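import Summits.Schanuel.Schanuel.Theorems.ZilberEacParamFibreCurve
import Summits.Schanuel.Schanuel.Theorems.ZilberEacParamSurfaceSwap
import Mathlib.Algebra.MvPolynomial.Division
import Mathlib.Algebra.MvPolynomial.Nilpotent
import HarnessLib

/-!
# Polynomially parametrised base curves, XXII: Mantova–Masser's density question for EVERY
# surface `{(g(t), y) : Q(t; y₀, y₁) = 0}` over a polynomial curve with `2 ≤ deg g₀ < deg g₁`
# under the phase condition (in particular whenever `deg g₀ ∤ deg g₁`)

HONEST FRAMING.  Cell `pub-schanuel` (Zilber's Exponential-Algebraic Closedness, case ladder;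
host summit Schanuel), seat 2, gen 20.  ASSEMBLY of gen 19 (`unprojectedDense_paramSurface₃`:
two `y₁`-degrees) and file XXI (`unprojectedDense_paramSurface₃_of_y0`: `Q ∈ ℂ[t, y₀]` with two
`y₀`-degrees, phase condition) with the elementary TRICHOTOMY for an irreducible
`Q ∈ ℂ[t, y₀, y₁]` whose zero set has a torus point over infinitely many `t`: either `Q` has two
monomials of different `y₁`-degree, or `Q ∈ ℂ[t, y₀]` has two monomials of different `y₀`-degree
(the remaining possibilities — all monomials divisible by `y₁` or by `y₀`, i.e. `Q = u·yᵢ`, or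
`Q ∈ ℂ[t]` — have no, resp. finitely many, torus fibres).  THEOREM
(`unprojectedDensityQuestion_paramSurface₃_complete`): `d = deg g₀ ≥ 2`, `d < n = deg g₁`,
`d ∤ n ∨ Re(lc(g₁)(i/lc(g₀))^{n/d}) ≠ 0`; `Q` irreducible with a zero in `(ℂˣ)²` over infinitely
many `t` ⟹ `S(g; Q) = {(g₀(t), g₁(t), y₀, y₁) : Q(t; y₀, y₁) = 0}` is in Mantova–Masser's case
(dim-π-S-1-free) AND its exponential points are Zariski dense.  So their question (PLMS 2024 §1
p. 5, OPEN in general) holds for EVERY surface of this explicit form over EVERY polynomial curve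
with `2 ≤ deg g₀ < deg g₁`, `deg g₀ ∤ deg g₁` (e.g. the cusp `(t², t³)`, and every `(t^d, t^n)` with
`d ∤ n`); mirror for `2 ≤ deg g₁ < deg g₀` by the index swap; new unconditional members of
`EC(3,2)` via THEOREM F′.  What stays OPEN here (precisely): `d ∣ n` with vanishing phase and
`Q ∈ ℂ[t, y₀]`; `deg g₀ = 1` (graphs: gens 17–18, complete off the equimodular class); abstract `W`
of the case whose base is `g(ℂ)` but which is not of the form `S(g; Q)` (dictionary lemma); equal
degrees; general algebraic base curves; Fib(3,2); EC(3,2).  NOT Schanuel's conjecture (neither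
used nor implied; EAC ⇏ SC).
-/

noncomputable section

open Filter Topology Set Complex MvPolynomial
open Literature.NumberTheory.Transcendental Literature.ModelTheory.Zilber
open Literature.ModelTheory.ExponentialFields

set_option linter.dupNamespace false

namespace Summit.Schanuel.Schanuel.Theorems

/-! ## Part A. The trichotomy for irreducible `Q ∈ ℂ[t, y₀, y₁]` with torus fibres -/

section Algebra

variable {σ : Type*} {R : Type*} [CommSemiring R]

/-- If every monomial of `Q` involves the variable `i`, then `X i ∣ Q`. -/
theorem X_dvd_of_forall_mem_support (Q : MvPolynomial σ R) (i : σ)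
    (h : ∀ m ∈ Q.support, 1 ≤ m i) : X i ∣ Q := by
  classical
  have hs : X i ∣ ∑ v ∈ Q.support, monomial v (coeff v Q) := by
    refine Finset.dvd_sum fun m hm => ?_
    rw [X]
    exact monomial_dvd_monomial.2 ⟨Or.inr (Finsupp.single_le_iff.2 (h m hm)), one_dvd _⟩
  rwa [← Q.as_sum] at hs

end Algebra

section Trichotomy

variable {Q : MvPolynomial (Fin 3) ℂ}

/-- An irreducible `Q ∈ ℂ[t, y₀, y₁]` all of whose monomials involve the variable `i` is `u · X i`
with `u ≠ 0`. -/
theorem eq_C_mul_X_of_irreducible (hirr : Irreducible Q) (i : Fin 3)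
    (h : ∀ m ∈ Q.support, 1 ≤ m i) : ∃ u : ℂ, u ≠ 0 ∧ Q = MvPolynomial.C u * X i := by
  obtain ⟨R, hR⟩ := X_dvd_of_forall_mem_support Q i h
  have hRu : IsUnit R := by
    rcases hirr.isUnit_or_isUnit hR with hX | hR'
    · exact absurd hX (MvPolynomial.X_prime (R := ℂ) (σ := Fin 3) (i := i)).not_unit
    · exact hR'
  obtain ⟨u, hu, rfl⟩ := MvPolynomial.isUnit_iff_eq_C_of_isReduced.1 hRu
  exact ⟨u, hu.ne_zero, by rw [hR, mul_comm]⟩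

/-- `u · y₀` and `u · y₁` (`u ≠ 0`) have no zero with `y ∈ (ℂˣ)²`. -/
theorem torusFibres_eq_empty_of_eq_C_mul_X {u : ℂ} (hu : u ≠ 0) {i : Fin 3} (hi : i ≠ 0) :
    {t : ℂ | ∃ c : Fin 2 → ℂ, c 0 ≠ 0 ∧ c 1 ≠ 0 ∧
      MvPolynomial.eval ![t, c 0, c 1] (MvPolynomial.C u * X i : MvPolynomial (Fin 3) ℂ) = 0} =
      ∅ := by
  ext t
  simp only [Set.mem_setOf_eq, Set.mem_empty_iff_false, iff_false, not_exists, not_and]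
  intro c h0 h1
  rw [map_mul, MvPolynomial.eval_C, MvPolynomial.eval_X]
  refine mul_ne_zero hu ?_
  fin_cases i
  · exact absurd rfl hi
  · simpa using h0
  · simpa using h1

/-- If `Q ∈ ℂ[t]` (no `y₀`, no `y₁`) and `Q ≠ 0`, only finitely many `t` carry a fibre zero. -/
theorem torusFibres_finite_of_support_t (hQ : Q ≠ 0) (hQ1 : ∀ m ∈ Q.support, m 1 = 0)
    (hQ2 : ∀ m ∈ Q.support, m 2 = 0) :
    Set.Finite {t : ℂ | ∃ c : Fin 2 → ℂ, c 0 ≠ 0 ∧ c 1 ≠ 0 ∧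
      MvPolynomial.eval ![t, c 0, c 1] Q = 0} := by
  classical
  set q : Polynomial ℂ := ∑ m ∈ Q.support, Polynomial.C (Q.coeff m) * Polynomial.X ^ (m 0)
    with hq
  -- `Q(t; c) = q(t)`
  have heval : ∀ (t : ℂ) (c : Fin 2 → ℂ), MvPolynomial.eval ![t, c 0, c 1] Q = q.eval t := by
    intro t c
    rw [eval₃_eq_sum_coeffPoly, hq, Polynomial.eval_finsetSum]
    refine Finset.sum_congr rfl fun m hm => ?_
    rw [hQ1 m hm, hQ2 m hm, pow_zero, pow_zero, mul_one, mul_one]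
  -- `q ≠ 0`: the exponent vectors in the support are determined by their `t`-degree
  have hinj : ∀ m ∈ Q.support, ∀ m' ∈ Q.support, m 0 = m' 0 → m = m' := by
    intro m hm m' hm' h0
    ext i
    fin_cases i
    · exact h0
    · show m 1 = m' 1
      rw [hQ1 m hm, hQ1 m' hm']
    · show m 2 = m' 2
      rw [hQ2 m hm, hQ2 m' hm']
  obtain ⟨m₀, hm₀⟩ := Finset.nonempty_iff_ne_empty.2 (MvPolynomial.support_eq_empty.not.2 hQ)
  have hq0 : q ≠ 0 := by
    intro h
    have hc : q.coeff (m₀ 0) = Q.coeff m₀ := by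
      rw [hq, Polynomial.finsetSum_coeff, Finset.sum_eq_single m₀]
      · rw [Polynomial.coeff_C_mul, Polynomial.coeff_X_pow, if_pos rfl, mul_one]
      · intro m hm hne
        rw [Polynomial.coeff_C_mul, Polynomial.coeff_X_pow, if_neg, mul_zero]
        exact fun h' => hne (hinj m hm m₀ hm₀ h'.symm)
      · intro h'; exact (h' hm₀).elim
    rw [h, Polynomial.coeff_zero] at hc
    exact MvPolynomial.mem_support_iff.1 hm₀ hc.symm
  refine (Polynomial.finite_setOf_isRoot hq0).subset ?_
  rintro t ⟨c, -, -, hc⟩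
  rw [heval] at hc
  exact hc

/-- **Trichotomy.**  An irreducible `Q ∈ ℂ[t, y₀, y₁]` with a zero in `(ℂˣ)²` over infinitely many
`t` either has two monomials of different `y₁`-degree, or lies in `ℂ[t, y₀]` (no `y₁`) and has two
monomials of different `y₀`-degree. (new) -/
theorem two_y1_degrees_or_y0_of_torusFibres (hirr : Irreducible Q)
    (hfib : Set.Infinite {t : ℂ | ∃ c : Fin 2 → ℂ, c 0 ≠ 0 ∧ c 1 ≠ 0 ∧
      MvPolynomial.eval ![t, c 0, c 1] Q = 0}) :
    (∃ m ∈ Q.support, ∃ m' ∈ Q.support, m 2 ≠ m' 2) ∨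
      ((∀ m ∈ Q.support, m 2 = 0) ∧ ∃ m ∈ Q.support, ∃ m' ∈ Q.support, m 1 ≠ m' 1) := by
  classical
  by_cases hA : ∃ m ∈ Q.support, ∃ m' ∈ Q.support, m 2 ≠ m' 2
  · exact Or.inl hA
  push Not at hA
  -- no monomial involves `y₁`
  have hQ2 : ∀ m ∈ Q.support, m 2 = 0 := by
    by_contra hcon
    push Not at hcon
    obtain ⟨m₀, hm₀, hm₀2⟩ := hcon
    have hall : ∀ m ∈ Q.support, 1 ≤ m 2 := fun m hm => by
      have := hA m hm m₀ hm₀; omega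
    obtain ⟨u, hu, hQ⟩ := eq_C_mul_X_of_irreducible hirr 2 hall
    refine hfib ?_
    rw [hQ, torusFibres_eq_empty_of_eq_C_mul_X hu (by decide : (2 : Fin 3) ≠ 0)]
    exact Set.finite_empty
  refine Or.inr ⟨hQ2, ?_⟩
  by_contra hB
  push Not at hB
  -- then no monomial involves `y₀` either, and `Q ∈ ℂ[t]` has finitely many fibres
  have hQ1 : ∀ m ∈ Q.support, m 1 = 0 := by
    by_contra hcon
    push Not at hcon
    obtain ⟨m₀, hm₀, hm₀1⟩ := hcon
    have hall : ∀ m ∈ Q.support, 1 ≤ m 1 := fun m hm => by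
      have := hB m hm m₀ hm₀; omega
    obtain ⟨u, hu, hQ⟩ := eq_C_mul_X_of_irreducible hirr 1 hall
    refine hfib ?_
    rw [hQ, torusFibres_eq_empty_of_eq_C_mul_X hu (by decide : (1 : Fin 3) ≠ 0)]
    exact Set.finite_empty
  exact hfib (torusFibres_finite_of_support_t hirr.ne_zero hQ1 hQ2)

/-- For `Q ∈ ℂ[t, y₀]`, a torus fibre zero is a nonzero fibre root `Q(t; y, 1) = 0`, `y ≠ 0`. -/
theorem fibreRoots_infinite_of_torusFibres (hQ2 : ∀ m ∈ Q.support, m 2 = 0)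
    (hfib : Set.Infinite {t : ℂ | ∃ c : Fin 2 → ℂ, c 0 ≠ 0 ∧ c 1 ≠ 0 ∧
      MvPolynomial.eval ![t, c 0, c 1] Q = 0}) :
    Set.Infinite {t : ℂ | ∃ y : ℂ, y ≠ 0 ∧ MvPolynomial.eval ![t, y, 1] Q = 0} := by
  refine hfib.mono ?_
  rintro t ⟨c, h0, -, hc⟩
  refine ⟨c 0, h0, ?_⟩
  rw [eval₃_eq_sum_coeffPoly_of_y0 Q hQ2] at hc ⊢
  exact hc

end Trichotomy

/-! ## Part B. The complete theorem over polynomial curves with `2 ≤ deg g₀ < deg g₁` -/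

section Main

variable (g₀ g₁ : Polynomial ℂ) {Q : MvPolynomial (Fin 3) ℂ}

/-- **MAIN THEOREM (every `Q`, `2 ≤ deg g₀ < deg g₁`, phase condition).**  `d = deg g₀ ≥ 2`,
`d < n = deg g₁`, `d ∤ n ∨ Re(lc(g₁)(i/lc(g₀))^{n/d}) ≠ 0`; `Q ∈ ℂ[t, y₀, y₁]` irreducible with a
zero in `(ℂˣ)²` over infinitely many `t` ⟹ `S(g; Q) = {(g₀(t), g₁(t), y₀, y₁) : Q(t; y₀, y₁) = 0}`
is in Mantova–Masser's case (dim-π-S-1-free) AND its exponential points are Zariski dense.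
[cite: MantovaMasser2023, §1 Further remarks, p. 5 (the question, open in general)] (new) -/
theorem unprojectedDensityQuestion_paramSurface₃_complete (hd : 2 ≤ g₀.natDegree)
    (hlt : g₀.natDegree < g₁.natDegree)
    (hph : ¬ g₀.natDegree ∣ g₁.natDegree ∨
      (g₁.leadingCoeff * (I / g₀.leadingCoeff) ^ (g₁.natDegree / g₀.natDegree)).re ≠ 0)
    (hirr : Irreducible Q)
    (hfib : Set.Infinite {t : ℂ | ∃ c : Fin 2 → ℂ, c 0 ≠ 0 ∧ c 1 ≠ 0 ∧
      MvPolynomial.eval ![t, c 0, c 1] Q = 0}) :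
    MMCaseDimPiOneFree {w : Fin 2 ⊕ Fin 2 → ℂ | ∃ t : ℂ, w (Sum.inl 0) = g₀.eval t ∧
        w (Sum.inl 1) = g₁.eval t ∧
        MvPolynomial.eval (Fin.cases t (fun i => w (Sum.inr i)) : Fin 3 → ℂ) Q = 0} ∧
      UnprojectedDense {w : Fin 2 ⊕ Fin 2 → ℂ | ∃ t : ℂ, w (Sum.inl 0) = g₀.eval t ∧
        w (Sum.inl 1) = g₁.eval t ∧
        MvPolynomial.eval (Fin.cases t (fun i => w (Sum.inr i)) : Fin 3 → ℂ) Q = 0} := by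
  rcases two_y1_degrees_or_y0_of_torusFibres hirr hfib with h2 | ⟨hQ2, h1⟩
  · exact unprojectedDensityQuestion_instance_paramSurface₃ g₀ g₁ (by omega) hlt hirr h2 hfib
  · exact unprojectedDensityQuestion_instance_paramSurface₃_of_y0 g₀ g₁ hd (by omega) hph hirr hQ2
      h1 (fibreRoots_infinite_of_torusFibres hQ2 hfib)

/-- **Unequal degrees not dividing each other need no phase condition.**  `2 ≤ deg g₀ < deg g₁`,
`deg g₀ ∤ deg g₁`; `Q` irreducible with a zero in `(ℂˣ)²` over infinitely many `t` ⟹ case ∧ dense.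
[cite: MantovaMasser2023, §1 Further remarks, p. 5 (the question, open in general)] (new) -/
theorem unprojectedDensityQuestion_paramSurface₃_complete_of_not_dvd (hd : 2 ≤ g₀.natDegree)
    (hlt : g₀.natDegree < g₁.natDegree) (hndvd : ¬ g₀.natDegree ∣ g₁.natDegree)
    (hirr : Irreducible Q)
    (hfib : Set.Infinite {t : ℂ | ∃ c : Fin 2 → ℂ, c 0 ≠ 0 ∧ c 1 ≠ 0 ∧
      MvPolynomial.eval ![t, c 0, c 1] Q = 0}) :
    MMCaseDimPiOneFree {w : Fin 2 ⊕ Fin 2 → ℂ | ∃ t : ℂ, w (Sum.inl 0) = g₀.eval t ∧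
        w (Sum.inl 1) = g₁.eval t ∧
        MvPolynomial.eval (Fin.cases t (fun i => w (Sum.inr i)) : Fin 3 → ℂ) Q = 0} ∧
      UnprojectedDense {w : Fin 2 ⊕ Fin 2 → ℂ | ∃ t : ℂ, w (Sum.inl 0) = g₀.eval t ∧
        w (Sum.inl 1) = g₁.eval t ∧
        MvPolynomial.eval (Fin.cases t (fun i => w (Sum.inr i)) : Fin 3 → ℂ) Q = 0} :=
  unprojectedDensityQuestion_paramSurface₃_complete g₀ g₁ hd hlt (Or.inl hndvd) hirr hfib

/-- **If the question is posed, it holds** (`2 ≤ deg g₀ < deg g₁`, phase condition): for every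
irreducible `Q`, `MMCaseDimPiOneFree S(g; Q) → UnprojectedDense S(g; Q)` — the case hypothesis
supplies a torus point, and a torus point over ONE `t` already forces one of the two density
mechanisms unless `Q ∈ ℂ[t]`; we assume torus fibres over infinitely many `t` to exclude the latter
uniformly. [cite: MantovaMasser2023, §1 Further remarks, p. 5] (new) -/
theorem unprojectedDense_paramSurface₃_of_torusFibres (hd : 2 ≤ g₀.natDegree)
    (hlt : g₀.natDegree < g₁.natDegree)
    (hph : ¬ g₀.natDegree ∣ g₁.natDegree ∨
      (g₁.leadingCoeff * (I / g₀.leadingCoeff) ^ (g₁.natDegree / g₀.natDegree)).re ≠ 0)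
    (hirr : Irreducible Q)
    (hfib : Set.Infinite {t : ℂ | ∃ c : Fin 2 → ℂ, c 0 ≠ 0 ∧ c 1 ≠ 0 ∧
      MvPolynomial.eval ![t, c 0, c 1] Q = 0}) :
    UnprojectedDense {w : Fin 2 ⊕ Fin 2 → ℂ | ∃ t : ℂ, w (Sum.inl 0) = g₀.eval t ∧
        w (Sum.inl 1) = g₁.eval t ∧
        MvPolynomial.eval (Fin.cases t (fun i => w (Sum.inr i)) : Fin 3 → ℂ) Q = 0} :=
  (unprojectedDensityQuestion_paramSurface₃_complete g₀ g₁ hd hlt hph hirr hfib).2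

/-- **Mirror (`2 ≤ deg g₁ < deg g₀`)** by the index swap `x₀ ↔ x₁`, `y₀ ↔ y₁`.
[cite: MantovaMasser2023, §1 Further remarks, p. 5 (the question, open in general)] (new) -/
theorem unprojectedDensityQuestion_paramSurface₃_complete_of_gt (hd : 2 ≤ g₁.natDegree)
    (hlt : g₁.natDegree < g₀.natDegree)
    (hph : ¬ g₁.natDegree ∣ g₀.natDegree ∨
      (g₀.leadingCoeff * (I / g₁.leadingCoeff) ^ (g₀.natDegree / g₁.natDegree)).re ≠ 0)
    (hirr : Irreducible Q)
    (hfib : Set.Infinite {t : ℂ | ∃ c : Fin 2 → ℂ, c 0 ≠ 0 ∧ c 1 ≠ 0 ∧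
      MvPolynomial.eval ![t, c 0, c 1] Q = 0}) :
    MMCaseDimPiOneFree {w : Fin 2 ⊕ Fin 2 → ℂ | ∃ t : ℂ, w (Sum.inl 0) = g₀.eval t ∧
        w (Sum.inl 1) = g₁.eval t ∧
        MvPolynomial.eval (Fin.cases t (fun i => w (Sum.inr i)) : Fin 3 → ℂ) Q = 0} ∧
      UnprojectedDense {w : Fin 2 ⊕ Fin 2 → ℂ | ∃ t : ℂ, w (Sum.inl 0) = g₀.eval t ∧
        w (Sum.inl 1) = g₁.eval t ∧
        MvPolynomial.eval (Fin.cases t (fun i => w (Sum.inr i)) : Fin 3 → ℂ) Q = 0} := by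
  obtain ⟨hc, hdns⟩ := unprojectedDensityQuestion_paramSurface₃_complete g₁ g₀ hd hlt hph
    (irreducible_rename_swap12 hirr) (torusFibres_rename_swap12 hfib)
  refine ⟨?_, ?_⟩
  · rw [paramSurface₃_eq_indexSwapped]
    exact mmCaseDimPiOneFree_indexSwapped hc
  · rw [paramSurface₃_eq_indexSwapped, unprojectedDense_indexSwapped_iff]
    exact hdns

end Main

/-! ## Part C. On the rung: threefolds fibred in curves over `S(g; Q)` meet `Γ_exp` -/

/-- **New members of `EC(3,2)`.**  An irreducible threefold `W ⊆ ℂ³ × ℂ³` of dimension `3` meeting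
the torus, with `dim cl[Δ₂](W ∩ G³) = 2`, whose projected surface `cl pr(W ∩ G³)` is `S(g; Q)`
(`2 ≤ deg g₀ < deg g₁`, phase condition, `Q` irreducible with a zero in `(ℂˣ)²` over infinitely many
`t`), meets the graph of exponentiation (THEOREM F′; no rotundity or freeness hypothesis).
[cite: MantovaMasser2023, §1 Further remarks, p. 5] (new) -/
theorem inter_expGraph_nonempty_of_fibred_over_paramSurface₃_complete (g₀ g₁ : Polynomial ℂ)
    (hd : 2 ≤ g₀.natDegree) (hlt : g₀.natDegree < g₁.natDegree)
    (hph : ¬ g₀.natDegree ∣ g₁.natDegree ∨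
      (g₁.leadingCoeff * (I / g₀.leadingCoeff) ^ (g₁.natDegree / g₀.natDegree)).re ≠ 0)
    {Q : MvPolynomial (Fin 3) ℂ} (hirr : Irreducible Q)
    (hQfib : Set.Infinite {t : ℂ | ∃ c : Fin 2 → ℂ, c 0 ≠ 0 ∧ c 1 ≠ 0 ∧
      MvPolynomial.eval ![t, c 0, c 1] Q = 0})
    {W : Set (Fin (2 + 1) ⊕ Fin (2 + 1) → ℂ)}
    (hW : IsIrreducibleClosed ℂ W) (hne : (W ∩ torusLocus ℂ (2 + 1)).Nonempty)
    (hdim : zariskiDim ℂ W = (2 + 1 : ℕ))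
    (hfib : zariskiDim ℂ (matrixAct (dropLastMat 2) '' (W ∩ torusLocus ℂ (2 + 1))) = (2 : ℕ))
    (hV : zeroLocus ℂ (vanishingIdeal ℂ
      ((fun (w : Fin (2 + 1) ⊕ Fin (2 + 1) → ℂ) (t : Fin 2 ⊕ Fin 2) =>
        w (Sum.map Fin.castSucc Fin.castSucc t)) '' (W ∩ torusLocus ℂ (2 + 1)))) =
      {w : Fin 2 ⊕ Fin 2 → ℂ | ∃ t : ℂ, w (Sum.inl 0) = g₀.eval t ∧ w (Sum.inl 1) = g₁.eval t ∧
        MvPolynomial.eval (Fin.cases t (fun i => w (Sum.inr i)) : Fin 3 → ℂ) Q = 0}) :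
    (W ∩ expGraph ℂ (2 + 1)).Nonempty :=
  inter_expGraph_nonempty_of_unprojectedDense_proj hW hne hdim hfib
    (by rw [hV]; exact unprojectedDense_paramSurface₃_of_torusFibres g₀ g₁ hd hlt hph hirr hQfib)

end Summit.Schanuel.Schanuel.Theorems
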